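import Literature.MathematicalPhysics.QuantumLattice.OpenMPSProductExpectation
import Literature.MathematicalPhysics.QuantumLattice.TransferOperatorPerron
import Literature.LinearAlgebra.Matrix.PosSemidefTrace
import HarnessLib

/-!
# uMPS dual certificates: the tensor-side bound `Σ_bonds ⟨X⟩ ≤ (N−1)·c + 2z`

HONEST FRAMING: first certified bounds; not a superconductivity verdict; every number certified or
labelled float.

Venture `Ventures/CertifiedManyBodySolver` (sr-mbsolver), the TENSOR-SIDE half of VAR's
`METHOD-umps.md` Theorem U1 (steps (a) finitely-correlated trial states and (b) telescoping;
`U1-LEMMAS.md` L2, L3, L4, L5(iii), L6), over `ℂ` with `ᴴ` in the tree's matrix-product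
vocabulary (`MPSTensor`, `mpsOpen`, `transferOp`, `onSite`):

Fix an MPS tensor `A : Fin q → M_D(ℂ)` which is LEFT-ISOMETRIC, `Σ_s (A s)ᴴ A s = 1`
(equivalently: the transfer operator `𝔼(M) = Σ_s A s M (A s)ᴴ` preserves traces), a two-site
matrix `X` (rows/columns indexed by `Fin q × Fin q` = (left site, right site)), any `Z ∈ M_D(ℂ)`,
and the right boundary vector `r`. With the Heisenberg map `Φ(B) = Σ_s (A s)ᴴ B (A s)`
(`heisenberg`), the bond image `Y_X = Σ_{p p'} X_{p p'} (A p₁ A p₂)ᴴ (A p'₁ A p'₂)` (`bondImage`)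
and the dual matrix `W = Y_X + Φ(Z) − Z` (`dualMatrix`):

* `trace_transferOp`, `trace_transferOp_pow` — trace preservation (L2);
  `trace_mul_heisenberg` — duality `Tr(M Φ(B)) = Tr(𝔼(M) B)` (L3);
* `sum_star_mpsOpen_dotProduct_twoSiteOp_mulVec` — **two-site insertion** (L5(iii)): for the
  open-boundary MPS vectors `ψ_a = mpsOpen N A e_a r` (left boundary vector running over the
  standard basis) and `X` placed on the bond `(j, j+1)` of the chain `Fin N`,
  `Σ_a ⟨ψ_a, X_{j,j+1} ψ_a⟩ = Tr (𝔼^{N−2−j}(r r†) · Y_X)`;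
* `sum_star_mpsOpen_dotProduct_mpsOpen_eq` — `Σ_a ‖ψ_a‖² = ‖r‖²`;
* `re_sum_star_mpsOpen_dotProduct_bondSum_mulVec_le` — **telescoping** (L4 + L6): if
  `c·1 − W ⪰ 0`, `z·1 − Z ⪰ 0`, `z·1 + Z ⪰ 0` and `‖r‖ = 1` then on `n + 2` sites
  `Re Σ_a ⟨ψ_a, (Σ_{j ≤ n} X_{j,j+1}) ψ_a⟩ ≤ (n+1)·c + 2z`.

No gauge condition other than exact left-isometry is used (no injectivity, no fixed point, no
spectral gap); `X`, `Z` need not be Hermitian (if they are not, the positivity hypotheses are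
simply unsatisfiable or say more than needed). The fermionic/Jordan–Wigner identification and the
thermodynamic limit are NOT in this file (`Upper/UMPSEnergyBound.lean`; step (d) is the tree's
`groundEnergyAt_pathGraph_double_le_re_trace`). Nothing here is a claim about the Hubbard model.

References: VAR team, `HOME/var/METHOD-umps.md` v1.1 §1–§2 and `HOME/var/U1-LEMMAS.md` v1
(sr-mbsolver, 2026-08-20); M. Fannes, B. Nachtergaele, R. F. Werner, Comm. Math. Phys. 144 (1992)
443 (finitely correlated states, the maps `𝔼`); V. Zauner-Stauber et al., Phys. Rev. B 97 (2018)
045145 (VUMPS; `Z` = the left energy environment).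
-/

noncomputable section

open Matrix Finset
open scoped ComplexOrder BigOperators

namespace Summit.Ventures.CertifiedManyBodySolver.Upper

open Literature.MathematicalPhysics.QuantumLattice Literature.LinearAlgebra.Matrix

variable {q D : ℕ}

/-! ### Objects -/

/-- The Heisenberg (dual) transfer map `Φ(B) = Σ_s (A s)ᴴ B (A s)` of an MPS tensor
(METHOD-umps §1; the trace dual of the tree's `transferOp A`, see `trace_mul_heisenberg`). -/
def heisenberg (A : MPSTensor q D) (B : Matrix (Fin D) (Fin D) ℂ) : Matrix (Fin D) (Fin D) ℂ :=
  ∑ s, (A s)ᴴ * B * A s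

/-- The bond image `Y_X = Σ_{p p'} X_{p p'} (A p₁ A p₂)ᴴ (A p'₁ A p'₂)` of a two-site matrix `X`
(rows `p = (s₁, s₂)`, columns `p' = (t₁, t₂)`): "the bond operator pushed onto the bond space"
(METHOD-umps §1, `Y = Φ_g(1)`). -/
def bondImage (A : MPSTensor q D) (X : Matrix (Fin q × Fin q) (Fin q × Fin q) ℂ) :
    Matrix (Fin D) (Fin D) ℂ :=
  ∑ p : Fin q × Fin q, ∑ p' : Fin q × Fin q, X p p' • ((A p.1 * A p.2)ᴴ * (A p'.1 * A p'.2))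

/-- The dual (Poisson test-function) matrix `W(A; X, Z) = Y_X + Φ(Z) − Z` (METHOD-umps §1). -/
def dualMatrix (A : MPSTensor q D) (X : Matrix (Fin q × Fin q) (Fin q × Fin q) ℂ)
    (Z : Matrix (Fin D) (Fin D) ℂ) : Matrix (Fin D) (Fin D) ℂ :=
  bondImage A X + heisenberg A Z - Z

/-- The two-site matrix `X` placed on the bond `(j, j+1)` of the open chain `Fin N`:
`⟨σ| X_{j,j+1} |τ⟩ = X_{(σ_j, σ_{j+1}), (τ_j, τ_{j+1})} · Π_{k ∉ {j,j+1}} [σ_k = τ_k]`, written as the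
linear combination `Σ X_{(a,c),(b,d)} E^{(j)}_{ab} E^{(j+1)}_{cd}` of products of single-site
matrix units. -/
def twoSiteOp (N : ℕ) (j : ℕ) (hj : j + 1 < N) (X : Matrix (Fin q × Fin q) (Fin q × Fin q) ℂ) :
    Op (Fin N) q :=
  ∑ p : Fin q × Fin q, ∑ p' : Fin q × Fin q, X p p' •
    (onSite (⟨j, by omega⟩ : Fin N) (Matrix.single p.1 p'.1 (1 : ℂ)) *
      onSite (⟨j + 1, hj⟩ : Fin N) (Matrix.single p.2 p'.2 (1 : ℂ)))

/-- The nearest-neighbour sum `Σ_{j=0}^{n} X_{j,j+1}` on the open chain of `n + 2` sites. -/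
def bondSum (n : ℕ) (X : Matrix (Fin q × Fin q) (Fin q × Fin q) ℂ) : Op (Fin (n + 2)) q :=
  ∑ j : Fin (n + 1), twoSiteOp (n + 2) j (by omega) X

/-! ### L2: trace preservation; L3: duality -/

/-- **L2.** A left-isometric tensor has a trace-preserving transfer operator:
`Tr 𝔼(M) = Tr M`. -/
theorem trace_transferOp {A : MPSTensor q D} (hA : ∑ s, (A s)ᴴ * A s = 1)
    (M : Matrix (Fin D) (Fin D) ℂ) : (transferOp A M).trace = M.trace := by
  rw [transferOp_apply, trace_sum]
  have h : ∀ s, (A s * M * (A s)ᴴ).trace = ((A s)ᴴ * A s * M).trace := fun s => by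
    rw [Matrix.mul_assoc, trace_mul_comm, Matrix.mul_assoc, trace_mul_comm]
  simp only [h]
  rw [← trace_sum, ← Finset.sum_mul, hA, Matrix.one_mul]

/-- **L2, iterated.** `Tr 𝔼^k(M) = Tr M`. -/
theorem trace_transferOp_pow {A : MPSTensor q D} (hA : ∑ s, (A s)ᴴ * A s = 1) (k : ℕ)
    (M : Matrix (Fin D) (Fin D) ℂ) : ((transferOp A ^ k) M).trace = M.trace := by
  induction k with
  | zero => rw [pow_zero, Module.End.one_apply]
  | succ k ih => rw [pow_succ', Module.End.mul_apply, trace_transferOp hA, ih]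

/-- **L3.** Duality between the Heisenberg map and the transfer operator:
`Tr(M Φ(B)) = Tr(𝔼(M) B)`. -/
theorem trace_mul_heisenberg (A : MPSTensor q D) (B M : Matrix (Fin D) (Fin D) ℂ) :
    (M * heisenberg A B).trace = (transferOp A M * B).trace := by
  rw [heisenberg, transferOp_apply, Finset.mul_sum, Finset.sum_mul, trace_sum, trace_sum]
  refine Finset.sum_congr rfl fun s _ => ?_
  rw [← Matrix.mul_assoc, ← Matrix.mul_assoc, trace_mul_cycle (M * (A s)ᴴ) B (A s),
    Matrix.mul_assoc (A s) M]

/-! ### L5(iii): the two-site insertion formula -/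

/-- The generalised transfer operator of a matrix unit: `𝔼_{E_{ab}}(M) = A b · M · (A a)ᴴ`. -/
theorem transferOpGen_single (A : MPSTensor q D) (a b : Fin q) :
    (∑ i : Fin q, ∑ j : Fin q, (Matrix.single a b (1 : ℂ)) i j •
        LinearMap.mulLeftRight ℂ (A j, (A i)ᴴ)) =
      LinearMap.mulLeftRight ℂ (A b, (A a)ᴴ) := by
  have h : ∀ i j : Fin q, (Matrix.single a b (1 : ℂ)) i j • LinearMap.mulLeftRight ℂ (A j, (A i)ᴴ) =
      if a = i then (if b = j then LinearMap.mulLeftRight ℂ (A j, (A i)ᴴ) else 0) else 0 := by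
    intro i j
    have hs : (Matrix.single a b (1 : ℂ)) i j = if a = i ∧ b = j then 1 else 0 := rfl
    rw [hs]
    by_cases h1 : a = i
    · by_cases h2 : b = j
      · rw [if_pos ⟨h1, h2⟩, if_pos h1, if_pos h2, one_smul]
      · rw [if_neg (fun h => h2 h.2), if_pos h1, if_neg h2, zero_smul]
    · rw [if_neg (fun h => h1 h.1), if_neg h1, zero_smul]
  simp only [h]
  rw [Finset.sum_comm]
  simp only [Finset.sum_ite_eq, Finset.mem_univ, if_true]

/-- **L5(iii), one matrix unit pair.** For `j + 1 < N` and single-site matrix units at `j` and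
`j + 1`: `Σ_a ⟨ψ_a, E^{(j)}_{ab} E^{(j+1)}_{cd} ψ_a⟩ = Tr (𝔼^{N−2−j}(r r†) · (A a A c)ᴴ (A b A d))`
(left-isometry collapses the `j` transfer operators to the left of the bond). -/
theorem sum_star_mpsOpen_dotProduct_onSite_mul_onSite_mulVec {A : MPSTensor q D}
    (hA : ∑ s, (A s)ᴴ * A s = 1) (r : Fin D → ℂ) {N j : ℕ} (hj : j + 1 < N) (a b c d : Fin q) :
    ∑ l : Fin D, star (mpsOpen N A (Pi.single l 1) r) ⬝ᵥ
        ((onSite (⟨j, by omega⟩ : Fin N) (Matrix.single a b (1 : ℂ)) *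
          onSite (⟨j + 1, hj⟩ : Fin N) (Matrix.single c d (1 : ℂ))) *ᵥ
            mpsOpen N A (Pi.single l 1) r) =
      ((transferOp A ^ (N - 2 - j)) (vecMulVec r (star r)) * ((A a * A c)ᴴ * (A b * A d))).trace := by
  have hjN : j < N := by omega
  have hne : (⟨j, hjN⟩ : Fin N) ≠ ⟨j + 1, hj⟩ := fun h => by
    have := congrArg Fin.val h
    simp at this
  rw [show (⟨j, by omega⟩ : Fin N) = ⟨j, hjN⟩ from rfl, onSite_mul_onSite_eq_productOp hne,
    sum_star_mpsOpen_dotProduct_productOp_mulVec]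
  -- identify the chain of generalised transfer operators
  set G : Fin N → Matrix (Fin q) (Fin q) ℂ :=
    Function.update (Function.update (fun _ => 1) (⟨j + 1, hj⟩ : Fin N) (Matrix.single c d 1))
      ⟨j, hjN⟩ (Matrix.single a b 1) with hG
  have hGval : ∀ (k : ℕ) (hk : k < N), G ⟨k, hk⟩ = if k = j then Matrix.single a b 1
      else if k = j + 1 then Matrix.single c d 1 else 1 := by
    intro k hk
    simp only [hG, Function.update_apply, Fin.ext_iff]
  have hlist : (List.ofFn fun k : Fin N =>
      ∑ i : Fin q, ∑ i' : Fin q, G k i i' • LinearMap.mulLeftRight ℂ (A i', (A i)ᴴ)) =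
      List.replicate j (transferOp A) ++
        (LinearMap.mulLeftRight ℂ (A b, (A a)ᴴ) :: LinearMap.mulLeftRight ℂ (A d, (A c)ᴴ) ::
          List.replicate (N - 2 - j) (transferOp A)) := by
    apply List.ext_getElem
    · simp
      omega
    · intro k h₁ h₂
      rw [List.length_ofFn] at h₁
      rw [List.getElem_ofFn, hGval k h₁, List.getElem_append]
      simp only [List.length_replicate]
      by_cases hkj : k < j
      · rw [dif_pos hkj, List.getElem_replicate, if_neg (show k ≠ j by omega),
          if_neg (show k ≠ j + 1 by omega), transferOpGen_one]
      · rw [dif_neg hkj]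
        by_cases hk1 : k = j
        · rw [if_pos hk1, transferOpGen_single, List.getElem_cons, dif_pos (show k - j = 0 by omega)]
        · rw [if_neg hk1]
          by_cases hk2 : k = j + 1
          · rw [if_pos hk2, transferOpGen_single, List.getElem_cons,
              dif_neg (show k - j ≠ 0 by omega), List.getElem_cons,
              dif_pos (show k - j - 1 = 0 by omega)]
          · rw [if_neg hk2, transferOpGen_one, List.getElem_cons,
              dif_neg (show k - j ≠ 0 by omega), List.getElem_cons,
              dif_neg (show k - j - 1 ≠ 0 by omega), List.getElem_replicate]
  rw [hlist, List.prod_append, List.prod_cons, List.prod_cons, List.prod_replicate,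
    List.prod_replicate, Module.End.mul_apply, trace_transferOp_pow hA, Module.End.mul_apply,
    Module.End.mul_apply, LinearMap.mulLeftRight_apply, LinearMap.mulLeftRight_apply]
  -- `Tr (A b (A d σ (A c)ᴴ) (A a)ᴴ) = Tr (σ (A a A c)ᴴ (A b A d))`
  rw [conjTranspose_mul]
  set σ := (transferOp A ^ (N - 2 - j)) (vecMulVec r (star r))
  calc (A b * (A d * σ * (A c)ᴴ) * (A a)ᴴ).trace
      = ((A b * A d) * (σ * ((A c)ᴴ * (A a)ᴴ))).trace := by
        simp only [Matrix.mul_assoc]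
    _ = (σ * ((A c)ᴴ * (A a)ᴴ) * (A b * A d)).trace := trace_mul_comm _ _
    _ = (σ * ((A c)ᴴ * (A a)ᴴ * (A b * A d))).trace := by simp only [Matrix.mul_assoc]

/-- **L5(iii): two-site insertion.** For a left-isometric tensor, the open-boundary MPS vectors
`ψ_a = mpsOpen N A e_a r` and the two-site matrix `X` on the bond `(j, j+1)`:
`Σ_a ⟨ψ_a, X_{j,j+1} ψ_a⟩ = Tr (𝔼^{N−2−j}(r r†) · Y_X)` (METHOD-umps §2(a):
`ρ_N(g_{j,j+1}) = Tr[𝔼^{N−j−1}(σ₀) Y]` in 1-based numbering). -/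
theorem sum_star_mpsOpen_dotProduct_twoSiteOp_mulVec {A : MPSTensor q D}
    (hA : ∑ s, (A s)ᴴ * A s = 1) (r : Fin D → ℂ) (X : Matrix (Fin q × Fin q) (Fin q × Fin q) ℂ)
    {N j : ℕ} (hj : j + 1 < N) :
    ∑ l : Fin D, star (mpsOpen N A (Pi.single l 1) r) ⬝ᵥ
        (twoSiteOp N j hj X *ᵥ mpsOpen N A (Pi.single l 1) r) =
      ((transferOp A ^ (N - 2 - j)) (vecMulVec r (star r)) * bondImage A X).trace := by
  simp only [twoSiteOp, bondImage, Matrix.sum_mulVec, Matrix.smul_mulVec, dotProduct_sum,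
    dotProduct_smul, smul_eq_mul, Finset.mul_sum, Matrix.mul_smul, trace_sum, trace_smul]
  rw [Finset.sum_comm]
  refine Finset.sum_congr rfl fun p _ => ?_
  rw [Finset.sum_comm]
  refine Finset.sum_congr rfl fun p' _ => ?_
  rw [← Finset.mul_sum, sum_star_mpsOpen_dotProduct_onSite_mul_onSite_mulVec hA r hj]

/-- **Normalisation.** For a left-isometric tensor, `Σ_a ‖ψ_a‖² = ‖r‖²`. -/
theorem sum_star_mpsOpen_dotProduct_mpsOpen_eq {A : MPSTensor q D}
    (hA : ∑ s, (A s)ᴴ * A s = 1) (N : ℕ) (r : Fin D → ℂ) :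
    ∑ l : Fin D, star (mpsOpen N A (Pi.single l 1) r) ⬝ᵥ mpsOpen N A (Pi.single l 1) r =
      star r ⬝ᵥ r := by
  rw [sum_star_mpsOpen_dotProduct_mpsOpen, trace_transferOp_pow hA, trace_vecMulVec,
    dotProduct_comm]

/-! ### L4 + L6: the telescoping bound -/

/-- **L4.** `Re Tr(σ W) ≤ c · Re Tr σ` for `σ ⪰ 0` and `c·1 − W ⪰ 0`. -/
theorem re_trace_mul_le_of_posSemidef_sub {σ W : Matrix (Fin D) (Fin D) ℂ} (hσ : σ.PosSemidef)
    {c : ℝ} (hW : ((c : ℂ) • (1 : Matrix (Fin D) (Fin D) ℂ) - W).PosSemidef) :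
    (σ * W).trace.re ≤ c * σ.trace.re := by
  have h := re_trace_mul_nonneg_of_posSemidef hσ hW
  rw [Matrix.mul_sub, Matrix.mul_smul, Matrix.mul_one, trace_sub, trace_smul, smul_eq_mul,
    Complex.sub_re, Complex.re_ofReal_mul, sub_nonneg] at h
  exact h

/-- `Re Tr(σ Z) ≤ z · Re Tr σ` for `σ ⪰ 0` and `z·1 − Z ⪰ 0`; `−Re Tr(σ Z) ≤ z · Re Tr σ` for
`z·1 + Z ⪰ 0`. -/
theorem neg_re_trace_mul_le_of_posSemidef_add {σ Z : Matrix (Fin D) (Fin D) ℂ} (hσ : σ.PosSemidef)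
    {z : ℝ} (hZ : ((z : ℂ) • (1 : Matrix (Fin D) (Fin D) ℂ) + Z).PosSemidef) :
    -(σ * Z).trace.re ≤ z * σ.trace.re := by
  have h := re_trace_mul_nonneg_of_posSemidef hσ hZ
  rw [Matrix.mul_add, Matrix.mul_smul, Matrix.mul_one, trace_add, trace_smul, smul_eq_mul,
    Complex.add_re, Complex.re_ofReal_mul] at h
  linarith

/-- **L6: telescoping (METHOD-umps §2(b)).** For a left-isometric tensor `A`, a unit right
boundary vector `r`, a two-site matrix `X`, any `Z`, and real `c, z` with `c·1 − W(A;X,Z) ⪰ 0`,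
`z·1 − Z ⪰ 0`, `z·1 + Z ⪰ 0`: on the open chain of `n + 2` sites,
`Re Σ_a ⟨ψ_a, (Σ_{j=0}^{n} X_{j,j+1}) ψ_a⟩ ≤ (n+1)·c + 2z`.
Proof: by the insertion formula the bond sum is `Σ_{m=0}^{n} Tr(σ_m Y_X)` with the density
matrices `σ_m = 𝔼^m(r r†)`; `Y_X = W − Φ(Z) + Z` and `Tr(σ_m Φ(Z)) = Tr(σ_{m+1} Z)` telescope the
`Z` terms to `Tr(σ_0 Z) − Tr(σ_{n+1} Z)`, and `Re Tr(σ_m W) ≤ c`. -/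
theorem re_sum_star_mpsOpen_dotProduct_bondSum_mulVec_le {A : MPSTensor q D}
    (hA : ∑ s, (A s)ᴴ * A s = 1) {r : Fin D → ℂ} (hr : star r ⬝ᵥ r = 1)
    (X : Matrix (Fin q × Fin q) (Fin q × Fin q) ℂ) (Z : Matrix (Fin D) (Fin D) ℂ) {c z : ℝ}
    (hW : ((c : ℂ) • (1 : Matrix (Fin D) (Fin D) ℂ) - dualMatrix A X Z).PosSemidef)
    (hZ₁ : ((z : ℂ) • (1 : Matrix (Fin D) (Fin D) ℂ) - Z).PosSemidef)
    (hZ₂ : ((z : ℂ) • (1 : Matrix (Fin D) (Fin D) ℂ) + Z).PosSemidef) (n : ℕ) :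
    (∑ l : Fin D, star (mpsOpen (n + 2) A (Pi.single l 1) r) ⬝ᵥ
        (bondSum n X *ᵥ mpsOpen (n + 2) A (Pi.single l 1) r)).re ≤ ((n : ℝ) + 1) * c + 2 * z := by
  -- the density matrices `σ_m = 𝔼^m (r r†)`
  set σ : ℕ → Matrix (Fin D) (Fin D) ℂ := fun m => (transferOp A ^ m) (vecMulVec r (star r))
    with hσ
  have hσpsd : ∀ m, (σ m).PosSemidef := fun m =>
    transferOp_pow_posSemidef A m (posSemidef_vecMulVec_self_star r)
  have hσtr : ∀ m, (σ m).trace.re = 1 := fun m => by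
    rw [hσ, trace_transferOp_pow hA, trace_vecMulVec, dotProduct_comm, hr, Complex.one_re]
  have hσsucc : ∀ m, transferOp A (σ m) = σ (m + 1) := fun m => by
    rw [hσ]
    simp only
    rw [pow_succ', Module.End.mul_apply]
  -- the bond sum as `Σ_{m ≤ n} Tr(σ_m Y)`
  have hsum : ∑ l : Fin D, star (mpsOpen (n + 2) A (Pi.single l 1) r) ⬝ᵥ
      (bondSum n X *ᵥ mpsOpen (n + 2) A (Pi.single l 1) r) =
      ∑ m ∈ range (n + 1), (σ m * bondImage A X).trace := by
    simp only [bondSum, Matrix.sum_mulVec, dotProduct_sum]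
    rw [Finset.sum_comm]
    simp only [sum_star_mpsOpen_dotProduct_twoSiteOp_mulVec hA r X]
    rw [Fin.sum_univ_eq_sum_range (fun j => ((transferOp A ^ (n + 2 - 2 - j))
      (vecMulVec r (star r)) * bondImage A X).trace) (n + 1),
      ← Finset.sum_range_reflect (fun m => (σ m * bondImage A X).trace) (n + 1)]
    refine Finset.sum_congr rfl fun j hj => ?_
    rw [Finset.mem_range] at hj
    have he : n + 2 - 2 - j = n + 1 - 1 - j := by omega
    rw [he]
  -- `Tr(σ_m Y) = Tr(σ_m W) − Tr(σ_{m+1} Z) + Tr(σ_m Z)`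
  have hY : ∀ m, (σ m * bondImage A X).trace =
      (σ m * dualMatrix A X Z).trace - ((σ (m + 1) * Z).trace - (σ m * Z).trace) := by
    intro m
    have : bondImage A X = dualMatrix A X Z - heisenberg A Z + Z := by
      rw [dualMatrix]; abel
    rw [this, Matrix.mul_add, Matrix.mul_sub, trace_add, trace_sub, trace_mul_heisenberg, hσsucc]
    ring
  rw [hsum]
  simp only [hY]
  rw [Finset.sum_sub_distrib, Finset.sum_range_sub (fun m => (σ m * Z).trace), Complex.sub_re,
    Complex.re_sum, Complex.sub_re]
  -- bound each piece
  have hWm : ∀ m, (σ m * dualMatrix A X Z).trace.re ≤ c := fun m => by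
    have := re_trace_mul_le_of_posSemidef_sub (hσpsd m) hW
    rwa [hσtr, mul_one] at this
  have h0 : (σ 0 * Z).trace.re ≤ z := by
    have := re_trace_mul_le_of_posSemidef_sub (hσpsd 0) hZ₁
    rwa [hσtr, mul_one] at this
  have h1 : -(σ (n + 1) * Z).trace.re ≤ z := by
    have := neg_re_trace_mul_le_of_posSemidef_add (hσpsd (n + 1)) hZ₂
    rwa [hσtr, mul_one] at this
  have hS : ∑ m ∈ range (n + 1), (σ m * dualMatrix A X Z).trace.re ≤ ((n : ℝ) + 1) * c := by
    calc ∑ m ∈ range (n + 1), (σ m * dualMatrix A X Z).trace.re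
        ≤ ∑ m ∈ range (n + 1), c := Finset.sum_le_sum fun m _ => hWm m
      _ = ((n : ℝ) + 1) * c := by
          rw [Finset.sum_const, Finset.card_range, nsmul_eq_mul]
          push_cast
          ring
  linarith

end Summit.Ventures.CertifiedManyBodySolver.Upper

end
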